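import Literature.Probability.RandomPlanarGeometry.SelfAvoidingWalk
import HarnessLib

/-!
# Negative knowledge on crux `BoundaryTP2` (route SAWTotalPositivity), part 1: certified SAW enumeration

Support file for item stmt-CriticalPhenomena-7115 by the standing disprover
(refuter-cdisprove-stmt-CriticalPhenomena-7115-0).  Generic, everything proved:
`SAW.weight Ω δ a b univ` as a `tsum` (`weight_univ`); a first-step enumeration `pathsFrom` of the supports
of self-avoiding paths with completeness (`support_mem_pathsFrom`) and soundness
(`exists_walk_of_mem_pathsFrom`); hence two-sided bounds `tsum_pow_le_of_enum` / `sum_le_tsum_pow_of_enum`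
on `Σ_γ x^{|γ|}` by kernel-checkable lists, and `weight_univ_le_of_enum`.  Used by parts 2–4
(`BoundaryTP2Negative_Box3`, `…_WithoutInterlacing`, `…_Midpoints`).
-/

namespace Summit.CriticalPhenomena.SAWScalingLimit.Theorems.BoundaryTP2.Negative

open Literature.Probability.LatticeModels Literature.Probability.RandomPlanarGeometry
open scoped ENNReal

/-! ## §0 Generic tools: the weight as a sum, and upper bounds by certified path enumeration -/

section Weight

variable {Ω : Set ℂ} {δ : ℝ} {a b : Site 2}

/-- The total critical weight is the sum of `x_c^{|γ|}` over all SAWs. [folklore] -/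
theorem weight_univ (Ω : Set ℂ) (δ : ℝ) (a b : Site 2) :
    SAW.weight Ω δ a b Set.univ =
      ∑' γ : SAW.DomainSAW Ω δ a b, ENNReal.ofReal (SAW.criticalFugacity ^ γ.length) := by
  rw [SAW.weight, MeasureTheory.Measure.sum_apply _ MeasurableSet.univ]
  congr 1
  funext γ
  simp

/-- One explicit SAW bounds the total weight from below. [folklore] -/
theorem single_le_weight_univ (γ : SAW.DomainSAW Ω δ a b) :
    ENNReal.ofReal (SAW.criticalFugacity ^ γ.length) ≤ SAW.weight Ω δ a b Set.univ := by
  rw [← SAW.weight_singleton γ]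
  exact MeasureTheory.measure_mono (Set.subset_univ _)

end Weight

section Enum

variable {V : Type*}

/-- Enumeration (by first step) of the supports of all self-avoiding paths of length `≤ n` starting at
`u` and avoiding the vertices of `vis`; `nb u` is any list containing the neighbours of `u`, `eqb` a
Boolean equality test. [folklore] -/
def pathsFrom (eqb : V → V → Bool) (nb : V → List V) : ℕ → V → List V → List (List V)
  | 0, u, _ => [[u]]
  | n + 1, u, vis =>
      [u] :: ((nb u).filter fun w => !(vis.any (eqb w)) && !(eqb w u)).flatMap
        fun w => (pathsFrom eqb nb n w (u :: vis)).map (List.cons u)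

/-- Boolean test "the list ends at `b`". [folklore] -/
def endsAt (eqb : V → V → Bool) (b : V) (s : List V) : Bool :=
  match s.getLast? with
  | some v => eqb v b
  | none => false

variable {eqb : V → V → Bool}

/-- `List.any` with a faithful Boolean equality is list membership. [folklore] -/
theorem any_eqb_iff (heqb : ∀ u v, eqb u v = true ↔ u = v) {w : V} {l : List V} :
    l.any (eqb w) = true ↔ w ∈ l := by
  rw [List.any_eq_true]
  constructor
  · rintro ⟨x, hx, h⟩
    rw [heqb] at h
    rw [h]
    exact hx
  · intro h
    exact ⟨w, h, (heqb w w).2 rfl⟩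

/-- **Completeness of `pathsFrom`**: the support of every self-avoiding path of length `≤ n` from `u`
avoiding `vis` is listed. [folklore] -/
theorem support_mem_pathsFrom (heqb : ∀ u v, eqb u v = true ↔ u = v) {G : SimpleGraph V}
    {nb : V → List V} (hnb : ∀ u w, G.Adj u w → w ∈ nb u) :
    ∀ (n : ℕ) {u v : V} (p : G.Walk u v) (vis : List V),
      p.IsPath → p.length ≤ n → (∀ x ∈ p.support, x ∉ vis) → p.support ∈ pathsFrom eqb nb n u vis := by
  intro n
  induction n with
  | zero =>
    intro u v p vis hp hlen hvis
    cases p with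
    | nil => simp [pathsFrom]
    | cons h q => simp at hlen
  | succ n ih =>
    intro u v p vis hp hlen hvis
    cases p with
    | nil => simp [pathsFrom]
    | @cons _ w _ h q =>
      rw [SimpleGraph.Walk.cons_isPath_iff] at hp
      obtain ⟨hq, hu⟩ := hp
      have hlen' : q.length ≤ n := by
        simp only [SimpleGraph.Walk.length_cons] at hlen
        omega
      have hw : w ∈ q.support := q.start_mem_support
      have hwu : w ≠ u := fun h' => hu (h' ▸ hw)
      have hwvis : w ∉ vis := hvis w (by simp [hw])
      have hq' := ih q (u :: vis) hq hlen' (by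
        intro x hx
        simp only [List.mem_cons, not_or]
        exact ⟨fun hxu => hu (hxu ▸ hx), hvis x (by simp [hx])⟩)
      simp only [pathsFrom, SimpleGraph.Walk.support_cons, List.mem_cons, List.mem_flatMap, List.mem_map,
        List.mem_filter]
      refine Or.inr ⟨w, ⟨hnb u w h, ?_⟩, q.support, hq', rfl⟩
      have h1 : vis.any (eqb w) = false := by
        rw [Bool.eq_false_iff]
        intro h'
        exact hwvis ((any_eqb_iff heqb).1 h')
      have h2 : eqb w u = false := by
        rw [Bool.eq_false_iff]
        intro h'
        exact hwu ((heqb w u).1 h')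
      simp [h1, h2]

/-- The support of a walk starts at its first vertex. [folklore] -/
theorem head?_support_eq {G : SimpleGraph V} {u v : V} (p : G.Walk u v) : p.support.head? = some u := by
  cases p <;> rfl

/-- A walk is determined by its support. [folklore] -/
theorem walk_eq_of_support_eq {G : SimpleGraph V} :
    ∀ {u v : V} (p q : G.Walk u v), p.support = q.support → p = q := by
  intro u v p
  induction p with
  | nil =>
    intro q h
    cases q with
    | nil => rfl
    | cons h' q' =>
      have := congrArg List.length h
      simp at this
  | @cons u' w v' h p' ih =>
    intro q hq
    cases q with
    | nil =>
      have := congrArg List.length hq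
      simp at this
    | @cons _ w' _ h' q' =>
      simp only [SimpleGraph.Walk.support_cons, List.cons.injEq, true_and] at hq
      have hww : w = w' := by
        have h1 := congrArg List.head? hq
        rw [head?_support_eq, head?_support_eq] at h1
        exact Option.some.inj h1
      subst hww
      rw [ih q' hq]

/-- The support of a walk `u → b` ends at `b`, in Boolean form. [folklore] -/
theorem endsAt_support (heqb : ∀ u v, eqb u v = true ↔ u = v) {G : SimpleGraph V} {u b : V}
    (p : G.Walk u b) : endsAt eqb b p.support = true := by
  unfold endsAt
  rw [List.getLast?_eq_some_getLast p.support_ne_nil, SimpleGraph.Walk.getLast_support]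
  exact (heqb b b).2 rfl

end Enum

/-- **Soundness of `pathsFrom`**: every listed sequence is the support of a self-avoiding path from `u`
whose vertices other than `u` avoid `vis` (provided `nb` only lists neighbours). [folklore] -/
theorem exists_walk_of_mem_pathsFrom {V : Type*} {eqb : V → V → Bool} (heqb : ∀ u v, eqb u v = true ↔ u = v)
    {G : SimpleGraph V} {nb : V → List V} (hnb' : ∀ u w, w ∈ nb u → G.Adj u w) :
    ∀ (n : ℕ) {u : V} (vis s : List V), s ∈ pathsFrom eqb nb n u vis →
      ∃ v, ∃ p : G.Walk u v, p.IsPath ∧ p.support = s ∧ ∀ x ∈ s, x = u ∨ x ∉ vis := by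
  intro n
  induction n with
  | zero =>
    intro u vis s hs
    simp only [pathsFrom, List.mem_singleton] at hs
    subst hs
    exact ⟨u, .nil, .nil, rfl, by simp⟩
  | succ n ih =>
    intro u vis s hs
    simp only [pathsFrom, List.mem_cons, List.mem_flatMap, List.mem_map, List.mem_filter] at hs
    rcases hs with rfl | ⟨w, ⟨hw, hb⟩, s', hs', rfl⟩
    · exact ⟨u, .nil, .nil, rfl, by simp⟩
    · simp only [Bool.and_eq_true, Bool.not_eq_true'] at hb
      have hwvis : w ∉ vis := fun h => by
        have := (any_eqb_iff heqb).2 h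
        rw [hb.1] at this
        exact Bool.false_ne_true this
      have hwu : w ≠ u := fun h => by
        have := (heqb w u).2 h
        rw [hb.2] at this
        exact Bool.false_ne_true this
      obtain ⟨v, p, hp, hsupp, hinv⟩ := ih (u :: vis) s' hs'
      have hu : u ∉ p.support := by
        intro hmem
        rw [hsupp] at hmem
        rcases hinv u hmem with h | h
        · exact hwu h.symm
        · exact h List.mem_cons_self
      refine ⟨v, .cons (hnb' u w hw) p, (SimpleGraph.Walk.cons_isPath_iff _ _).2 ⟨hp, hu⟩,
        by rw [SimpleGraph.Walk.support_cons, hsupp], ?_⟩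
      intro x hx
      rw [List.mem_cons] at hx
      rcases hx with rfl | hx
      · exact Or.inl rfl
      · right
        rcases hinv x hx with rfl | h
        · exact hwvis
        · exact fun h' => h (List.mem_cons_of_mem _ h')

/-- **Upper bound by certified enumeration** (general fugacity `x`): if `nb` lists the neighbours of
the domain graph, every SAW from `a` has length `≤ N`, and the enumerated supports ending at `b` form a
duplicate-free list `L`, then `Σ_γ x^{|γ|} ≤ Σ_{s ∈ L} x^{|s|-1}`. [folklore] -/
theorem tsum_pow_le_of_enum {Ω : Set ℂ} {δ : ℝ} {a b : Site 2} {x : ℝ}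
    (eqb : Site 2 → Site 2 → Bool) (heqb : ∀ u v, eqb u v = true ↔ u = v)
    (nb : Site 2 → List (Site 2)) (hnb : ∀ u w, (discreteDomainGraph Ω δ).Adj u w → w ∈ nb u)
    (N : ℕ) (hN : ∀ γ : SAW.DomainSAW Ω δ a b, γ.length ≤ N)
    (hnodup : ((pathsFrom eqb nb N a []).filter (endsAt eqb b)).Nodup) :
    ∑' γ : SAW.DomainSAW Ω δ a b, ENNReal.ofReal (x ^ γ.length) ≤
      (((pathsFrom eqb nb N a []).filter (endsAt eqb b)).map
        fun s => ENNReal.ofReal (x ^ (s.length - 1))).sum := by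
  classical
  set L := (pathsFrom eqb nb N a []).filter (endsAt eqb b) with hL
  set g : List (Site 2) → ℝ≥0∞ := fun s => ENNReal.ofReal (x ^ (s.length - 1))
  rw [ENNReal.tsum_eq_iSup_sum]
  refine iSup_le fun F => ?_
  have hinj : Function.Injective fun γ : SAW.DomainSAW Ω δ a b => γ.walk.support := by
    intro γ γ' h
    have hw := walk_eq_of_support_eq γ.walk γ'.walk h
    cases γ; cases γ'
    simp only at hw
    subst hw
    rfl
  have hterm : ∀ γ : SAW.DomainSAW Ω δ a b, ENNReal.ofReal (x ^ γ.length) = g γ.walk.support := by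
    intro γ
    simp only [g, SimpleGraph.Walk.length_support, Nat.add_sub_cancel]
    rfl
  calc ∑ γ ∈ F, ENNReal.ofReal (x ^ γ.length)
      = ∑ γ ∈ F, g γ.walk.support := Finset.sum_congr rfl fun γ _ => hterm γ
    _ = ∑ s ∈ F.image (fun γ : SAW.DomainSAW Ω δ a b => γ.walk.support), g s :=
        (Finset.sum_image fun γ _ γ' _ h => hinj h).symm
    _ ≤ ∑ s ∈ L.toFinset, g s := by
        refine Finset.sum_le_sum_of_subset_of_nonneg (fun s hs => ?_) fun _ _ _ => bot_le
        rw [Finset.mem_image] at hs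
        obtain ⟨γ, -, rfl⟩ := hs
        rw [List.mem_toFinset, hL, List.mem_filter]
        exact ⟨support_mem_pathsFrom heqb hnb N γ.walk [] γ.isPath (hN γ) (by simp),
          endsAt_support heqb γ.walk⟩
    _ = (L.map g).sum := List.sum_toFinset _ hnodup

/-- **Lower bound by certified enumeration** (general fugacity `x`): if `nb` only lists neighbours of the
domain graph, `Σ_{s ∈ L} x^{|s|-1} ≤ Σ_γ x^{|γ|}` for the duplicate-free list `L` of enumerated supports
ending at `b`. [folklore] -/
theorem sum_le_tsum_pow_of_enum {Ω : Set ℂ} {δ : ℝ} {a b : Site 2} {x : ℝ}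
    (eqb : Site 2 → Site 2 → Bool) (heqb : ∀ u v, eqb u v = true ↔ u = v)
    (nb : Site 2 → List (Site 2)) (hnb' : ∀ u w, w ∈ nb u → (discreteDomainGraph Ω δ).Adj u w)
    (N : ℕ) (hnodup : ((pathsFrom eqb nb N a []).filter (endsAt eqb b)).Nodup) :
    (((pathsFrom eqb nb N a []).filter (endsAt eqb b)).map
        fun s => ENNReal.ofReal (x ^ (s.length - 1))).sum ≤
      ∑' γ : SAW.DomainSAW Ω δ a b, ENNReal.ofReal (x ^ γ.length) := by
  classical
  set L := (pathsFrom eqb nb N a []).filter (endsAt eqb b) with hL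
  set g : List (Site 2) → ℝ≥0∞ := fun s => ENNReal.ofReal (x ^ (s.length - 1))
  -- every listed support is the support of a SAW `a → b`
  have hex : ∀ s ∈ L, ∃ γ : SAW.DomainSAW Ω δ a b, γ.walk.support = s := by
    intro s hs
    rw [hL, List.mem_filter] at hs
    obtain ⟨v, p, hp, hsupp, -⟩ := exists_walk_of_mem_pathsFrom heqb hnb' N [] s hs.1
    have hvb : v = b := by
      have h1 := hs.2
      unfold endsAt at h1
      rw [← hsupp, List.getLast?_eq_some_getLast p.support_ne_nil, SimpleGraph.Walk.getLast_support] at h1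
      exact (heqb v b).1 h1
    subst hvb
    exact ⟨⟨p, hp⟩, hsupp⟩
  by_cases hLe : L = []
  · simp [hLe]
  obtain ⟨s₀, hs₀⟩ := List.exists_mem_of_ne_nil L hLe
  obtain ⟨γ₀, -⟩ := hex s₀ hs₀
  haveI : Nonempty (SAW.DomainSAW Ω δ a b) := ⟨γ₀⟩
  choose! γof hγof using hex
  have hinjL : ∀ s ∈ L, ∀ t ∈ L, γof s = γof t → s = t := fun s hs t ht h => by
    rw [← hγof s hs, ← hγof t ht, h]
  have hterm : ∀ s ∈ L, g s = ENNReal.ofReal (x ^ (γof s).length) := by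
    intro s hs
    simp only [g]
    rw [show (γof s).length = (γof s).walk.length from rfl, ← Nat.add_sub_cancel (γof s).walk.length 1,
      ← SimpleGraph.Walk.length_support, hγof s hs]
  calc (L.map g).sum = ∑ s ∈ L.toFinset, g s := (List.sum_toFinset _ hnodup).symm
    _ = ∑ s ∈ L.toFinset, ENNReal.ofReal (x ^ (γof s).length) :=
        Finset.sum_congr rfl fun s hs => hterm s (List.mem_toFinset.1 hs)
    _ = ∑ γ ∈ L.toFinset.image γof, ENNReal.ofReal (x ^ γ.length) :=
        (Finset.sum_image (f := fun γ : SAW.DomainSAW Ω δ a b => ENNReal.ofReal (x ^ γ.length))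
          fun s hs t ht h => hinjL s (List.mem_toFinset.1 hs) t (List.mem_toFinset.1 ht) h).symm
    _ ≤ _ := ENNReal.sum_le_tsum _

/-- **Upper bound on the critical weight by certified enumeration.** [folklore] -/
theorem weight_univ_le_of_enum {Ω : Set ℂ} {δ : ℝ} {a b : Site 2}
    (eqb : Site 2 → Site 2 → Bool) (heqb : ∀ u v, eqb u v = true ↔ u = v)
    (nb : Site 2 → List (Site 2)) (hnb : ∀ u w, (discreteDomainGraph Ω δ).Adj u w → w ∈ nb u)
    (N : ℕ) (hN : ∀ γ : SAW.DomainSAW Ω δ a b, γ.length ≤ N)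
    (hnodup : ((pathsFrom eqb nb N a []).filter (endsAt eqb b)).Nodup) :
    SAW.weight Ω δ a b Set.univ ≤
      (((pathsFrom eqb nb N a []).filter (endsAt eqb b)).map
        fun s => ENNReal.ofReal (SAW.criticalFugacity ^ (s.length - 1))).sum := by
  rw [weight_univ]
  exact tsum_pow_le_of_enum eqb heqb nb hnb N hN hnodup

/-- Paths of a graph all of whose edges have both ends in a finite set `T` have length `< |T|`. [folklore] -/
theorem length_lt_card_of_adj_mem {G : SimpleGraph (Site 2)} (T : Finset (Site 2))
    (hG : ∀ x y, G.Adj x y → x ∈ T ∧ y ∈ T) {u v : Site 2} (hu : u ∈ T) (p : G.Walk u v) (hp : p.IsPath) :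
    p.length + 1 ≤ T.card := by
  classical
  have hsub : p.support.toFinset ⊆ T := by
    intro x hx
    rw [List.mem_toFinset] at hx
    induction p with
    | nil => simp at hx; subst hx; exact hu
    | cons h q ih =>
      rw [SimpleGraph.Walk.support_cons, List.mem_cons] at hx
      rcases hx with rfl | hx
      · exact hu
      · exact ih (hG _ _ h).2 (SimpleGraph.Walk.IsPath.of_cons hp) hx
  have hcard := Finset.card_le_card hsub
  rw [List.toFinset_card_of_nodup hp.support_nodup, SimpleGraph.Walk.length_support] at hcard
  exact hcard


end Summit.CriticalPhenomena.SAWScalingLimit.Theorems.BoundaryTP2.Negative
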